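import Literature.NumberTheory.Automorphic.ArtinLFunctionsAbelianConductorProofs
import Literature.NumberTheory.GaloisRepresentations.GlobalReciprocityExistenceProofs
import Mathlib.NumberTheory.Padics.Complex
import HarnessLib

/-!
# Finite-order Hecke characters are characters of the absolute Galois group, with the same
# ramification; their `ℓ`-adic avatars (proved)

Topic `NumberTheory/GaloisRepresentations`; namespace
`Literature.NumberTheory.GaloisRepresentations`.  A *proofs* file: theorems, and one auxiliary
construction (`FramedGaloisRep.ofOpenKer`, a homomorphism with open kernel viewed as a rank-one
framed Galois representation); no named fact, no instance (D-0026).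

This is the degree-one, finite-order case of the dictionary "automorphic ↔ Galois" — the case
`n = 1` of Harris–Lan–Taylor–Thorne's Theorem A / Theorem 7.13 ("In the case `n = 1` the result
is well known", *Res. Math. Sci.* 3:37 (2016), p. 232) for Hecke characters of finite order — read
off the tree's (now complete) global class field theory:

* **(HG) holds for every number field** (`HeckeCharacter.exists_eq_charHecke_of_isFiniteOrder`):
  every Hecke character `η` of finite order of `K` is `χ ∘ ψ_{L|K}` (`charHecke L χ`) for a finite
  abelian `L ⊆ K̄` and a character `χ` of `G(L|K)` — Tate, *Global class field theory*
  (Cassels–Fröhlich Ch. VII) §5.1 Main Theorem (B), (D) in character form ("`φ` is admissible if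
  and only if it is a Grössencharakter", p. 209, with 4.2 and 5.1); in the tree this is
  `galoisHecke_of_keyLemma` (Tate's induction, `GlobalReciprocityKeyLemmaReductionProofs`) fed with
  the Key Lemma `exists_cyclic_charHecke_of_pow_prime_eq_one` (`GlobalReciprocityExistenceProofs`)
  and the reciprocity law `artinReciprocity_character_holds`.
* **`HeckeCharacter.exists_framedArtinRep_of_isFiniteOrder`** — hence every finite-order `η` is the
  Hecke character of a rank-one Artin representation `ψ : Γ_K → GL_1(ℂ)` which is **unramified
  exactly where `η` is**, with `ψ(Φ) = η(ϖ_v)` for every arithmetic Frobenius `Φ` above every such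
  place (`ψ.HasFrobCharpolyAt v (X - η(ϖ_v))`): the forward ramification clause and the Frobenius
  values are `artinReciprocity_character` (Tate 5.1 (A) with 4.2 (iii)), the converse clause
  "`η` unramified `⟹ ψ` unramified" is the conductor–ramification theorem (Neukirch, *Algebraic
  Number Theory*, VI (6.6), VII (10.6) Remark; tree:
  `Automorphic.isUnramifiedAt_of_heckeCharacter_isUnramifiedAt`,
  `artinReciprocity_character_primitive_holds`).  `ψ` is unique
  (`HeckeCharacter.framedArtinRep_unique`, Frobenius density, tree
  `FramedArtinRep.eq_of_valueAtUniformizer_eq_det`).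
* **`ℓ`-adic avatars.**  For a prime `ℓ` and a field isomorphism `ι : ℚ̄_ℓ ≃+* ℂ`
  (`ℚ̄_ℓ = PadicAlgCl ℓ`), `HeckeCharacter.exists_lAdic_of_isFiniteOrder`: there is a continuous
  `r : Γ_K → GL_1(ℚ̄_ℓ)` (`FramedGaloisRep K (PadicAlgCl ℓ) 1`), unramified exactly where `η` is,
  whose arithmetic Frobenius at every such `v` has characteristic polynomial
  `X - ι⁻¹(η(ϖ_v))⁻¹` — the normalisation of the tree's `arithFrobPolyOfSatake ι q_v 1 {η(ϖ_v)}`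
  (`Automorphic/ReciprocityGLn`: geometric Frobenius ↔ uniformizer) and of
  `exists_heckeCharacter_of_weaklyDivides` (`WeakAbelianDirectSummand`).  It is `σ ↦ ι⁻¹(ψ(σ))⁻¹`,
  continuous because `ker ψ` is open (`FramedGaloisRep.ofOpenKer`).  Serre, *Abelian ℓ-adic
  representations* (1968), Ch. III §2.3 ("the `ℓ`-adic representation attached to a character of
  finite order").

## References

* J. Tate, *Global class field theory*, Ch. VII in Cassels–Fröhlich, *Algebraic Number Theory*
  (1967), §3.7–3.8, §4.2, §5.1 Main Theorem (A), (B), (D). [CasselsFrohlichANT1967]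
* J. Neukirch, *Algebraic Number Theory* (1999), Ch. VI Cor. (6.6), Ch. VII Thm. (10.6) and Remark.
  [NeukirchANT1999]
* J.-P. Serre, *Abelian ℓ-adic representations and elliptic curves* (1968), Ch. III §2.3.
  [SerreAbelianLadic1968]
* M. Harris, K.-W. Lan, R. Taylor, J. Thorne, *On the rigid cohomology of certain Shimura
  varieties*, Res. Math. Sci. 3:37 (2016), p. 232 (Thm. 7.13, case `n = 1`).
  [HarrisLanTaylorThorneRMS2016]

## Mathlib / tree search

Tree: `galoisHecke_of_keyLemma`, `exists_cyclic_charHecke_of_pow_prime_eq_one`,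
`artinReciprocity_character_holds`, `charHecke`, `inflateCharacter`, `heckeOfArtinCharacter_spec`,
`FramedGaloisRep.hasFrobCharpolyAt_iff_of_rank_one`, `isUnramifiedAt_of_heckeCharacter_isUnramifiedAt`,
`FramedArtinRep.eq_of_valueAtUniformizer_eq_det`, `FramedArtinRep.isOpen_ker_toMonoidHom`,
`MonoidHom.continuous_of_isOpen_ker`, `FramedRep.unitsContinuousMulEquivOfUnique`; the tree's
`Rat.exists_framedArtinRep_of_isFiniteOrder` is the case `K = ℚ` (Kronecker–Weber route).
`lean search 'ofOpenKer|lAdicAvatar|exists_eq_charHecke_of_isFiniteOrder'`: no prior hits.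
-/

noncomputable section

open scoped NumberField Polynomial
open NumberField IsDedekindDomain Field Polynomial Filter

namespace Literature.NumberTheory.GaloisRepresentations

/-! ### §1. Homomorphisms with open kernel as rank-one framed Galois representations -/

namespace FramedGaloisRep

section OfOpenKer

variable {K : Type*} [Field K] {A : Type*} [CommRing A] [TopologicalSpace A] [IsTopologicalRing A]

/-- A homomorphism `θ : Γ_K → Aˣ` **with open kernel**, as a rank-one framed Galois representation
`Γ_K →ₜ* GL (Fin 1) A` (continuity from the open kernel, `MonoidHom.continuous_of_isOpen_ker`;
`Aˣ ≃ₜ* GL (Fin 1) A` by `FramedRep.unitsContinuousMulEquivOfUnique`).  Serre 1968, Ch. III §2.3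
(characters of finite order as `ℓ`-adic representations). [folklore] -/
def ofOpenKer (θ : absoluteGaloisGroup K →* Aˣ) (hθ : IsOpen (θ.ker : Set (absoluteGaloisGroup K))) :
    FramedGaloisRep K A 1 :=
  ContinuousMonoidHom.comp
    (FramedRep.unitsContinuousMulEquivOfUnique (Fin 1) A : Aˣ →ₜ* GL (Fin 1) A)
    ⟨θ, MonoidHom.continuous_of_isOpen_ker θ hθ⟩

/-- Matrix entries of `ofOpenKer θ`: the `1 × 1` matrix `(θ σ)`. [folklore] -/
@[simp] theorem ofOpenKer_apply_coe (θ : absoluteGaloisGroup K →* Aˣ)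
    (hθ : IsOpen (θ.ker : Set (absoluteGaloisGroup K))) (σ : absoluteGaloisGroup K) (i j : Fin 1) :
    ((ofOpenKer θ hθ σ : GL (Fin 1) A) : Matrix (Fin 1) (Fin 1) A) i j = θ σ :=
  rfl

/-- `ofOpenKer θ σ = 1 ↔ θ σ = 1`. [folklore] -/
theorem ofOpenKer_apply_eq_one_iff (θ : absoluteGaloisGroup K →* Aˣ)
    (hθ : IsOpen (θ.ker : Set (absoluteGaloisGroup K))) (σ : absoluteGaloisGroup K) :
    ofOpenKer θ hθ σ = 1 ↔ θ σ = 1 := by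
  constructor
  · intro h
    have h00 := congrArg (fun M : GL (Fin 1) A => (M : Matrix (Fin 1) (Fin 1) A) 0 0) h
    simp only [ofOpenKer_apply_coe, Units.val_one, Matrix.one_apply_eq] at h00
    exact Units.val_eq_one.mp h00
  · intro h
    ext i j
    rw [ofOpenKer_apply_coe, h, Units.val_one, Units.val_one,
      Subsingleton.elim i j, Matrix.one_apply_eq]

/-- `ofOpenKer θ` is unramified at `v` iff `θ` kills every inertia group above `v`. [folklore] -/
theorem isUnramifiedAt_ofOpenKer_iff [NumberField K] (θ : absoluteGaloisGroup K →* Aˣ)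
    (hθ : IsOpen (θ.ker : Set (absoluteGaloisGroup K))) (v : HeightOneSpectrum (𝓞 K)) :
    (ofOpenKer θ hθ).IsUnramifiedAt v ↔
      ∀ 𝔓 ∈ v.primesAbove, ∀ σ ∈ 𝔓.inertia (absoluteGaloisGroup K), θ σ = 1 := by
  refine forall₂_congr fun 𝔓 _ => forall₂_congr fun σ _ => ?_
  exact ofOpenKer_apply_eq_one_iff θ hθ σ

/-- Frobenius characteristic polynomials of `ofOpenKer θ`: `HasFrobCharpolyAt v (X - C a)` iff
`θ(Φ) = a` for every arithmetic Frobenius `Φ` above `v`. [folklore] -/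
theorem hasFrobCharpolyAt_ofOpenKer_iff [NumberField K] (θ : absoluteGaloisGroup K →* Aˣ)
    (hθ : IsOpen (θ.ker : Set (absoluteGaloisGroup K))) (v : HeightOneSpectrum (𝓞 K)) (a : A) :
    (ofOpenKer θ hθ).HasFrobCharpolyAt v (X - C a) ↔
      ∀ 𝔓 ∈ v.primesAbove, ∀ Φ : absoluteGaloisGroup K, IsArithFrobAt (𝓞 K) Φ 𝔓 →
        ((θ Φ : Aˣ) : A) = a := by
  rw [hasFrobCharpolyAt_iff_of_rank_one]
  refine forall₂_congr fun 𝔓 _ => forall₂_congr fun Φ _ => ?_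
  rw [ofOpenKer_apply_coe]

end OfOpenKer

end FramedGaloisRep

/-! ### §2. (HG): finite-order Hecke characters are class-field characters -/

variable {K : Type} [Field K] [NumberField K]

namespace HeckeCharacter

/-- **(HG) for every number field.**  Every Hecke character of finite order of `K` is the class-field
character `χ ∘ ψ_{L|K}` (`charHecke L χ`) of a character `χ` of the group of a finite abelian
`L ⊆ K̄` (Tate, Cassels–Fröhlich VII §5.1 (B), (D) in character form; tree: Tate's induction
`galoisHecke_of_keyLemma` with the Key Lemma `exists_cyclic_charHecke_of_pow_prime_eq_one` and
`artinReciprocity_character_holds`).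
[cite: CasselsFrohlichANT1967, Ch. VII §5.1 Main Theorem (B), (D) and §12] -/
theorem exists_eq_charHecke_of_isFiniteOrder (η : HeckeCharacter K) (hη : η.IsFiniteOrder) :
    ∃ (L : IntermediateField K (AlgebraicClosure K)) (_ : FiniteDimensional K L)
      (_ : IsAbelianGalois K L) (χ : (L ≃ₐ[K] L) →* ℂˣ),
      η = charHecke L χ artinReciprocity_character_holds :=
  galoisHecke_of_keyLemma artinReciprocity_character_holds
    exists_cyclic_charHecke_of_pow_prime_eq_one (orderOf η) K η rfl hη

/-- **Finite-order Hecke characters are Hecke characters of rank-one Artin representations with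
the same ramification.**  For every Hecke character `η` of finite order of the number field `K`
there is a continuous character `ψ : Γ_K → GL_1(ℂ)` such that, for every finite place `v`,
`ψ` is unramified at `v` iff `η` is, and then `ψ(Φ) = η(ϖ_v)` for every arithmetic Frobenius `Φ`
above `v` (`ψ.HasFrobCharpolyAt v (X - η(ϖ_v))`).  Tate, Cassels–Fröhlich VII §5.1 (A), (B), (D)
with §4.2 (iii); the clause "`η` unramified `⟹ ψ` unramified" is Neukirch VI (6.6) / VII (10.6)
Remark (tree: `isUnramifiedAt_of_heckeCharacter_isUnramifiedAt`).
[cite: CasselsFrohlichANT1967, Ch. VII §5.1 Main Theorem and §4.2 Corollary (iii)]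
[cite: NeukirchANT1999, Ch. VI Cor. (6.6); Ch. VII Thm. (10.6) Remark] -/
theorem exists_framedArtinRep_of_isFiniteOrder (η : HeckeCharacter K) (hη : η.IsFiniteOrder) :
    ∃ ψ : FramedArtinRep K 1,
      (∀ v : HeightOneSpectrum (𝓞 K), ψ.IsUnramifiedAt v ↔ η.IsUnramifiedAt v) ∧
      ∀ v : HeightOneSpectrum (𝓞 K), η.IsUnramifiedAt v →
        ψ.HasFrobCharpolyAt v (X - C (η.valueAtUniformizer v)) := by
  obtain ⟨L, hLfd, hLab, χ, hηχ⟩ := η.exists_eq_charHecke_of_isFiniteOrder hη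
  haveI := hLfd
  haveI := hLab
  set ψ : FramedArtinRep K 1 := inflateCharacter L χ with hψ
  have hηψ : heckeOfArtinCharacter artinReciprocity_character_holds ψ = η := hηχ.symm
  have hspec := (heckeOfArtinCharacter_spec artinReciprocity_character_holds ψ).2
  rw [hηψ] at hspec
  -- the "det" form of the Frobenius clause, as consumed by the conductor theorem
  have hdet : ∀ v : HeightOneSpectrum (𝓞 K), ψ.IsUnramifiedAt v →
      η.IsUnramifiedAt v ∧ ∀ 𝔓 ∈ v.primesAbove, ∀ Φ : absoluteGaloisGroup K,
        IsArithFrobAt (𝓞 K) Φ 𝔓 → η.valueAtUniformizer v = ((FramedRep.det ψ Φ : ℂˣ) : ℂ) := by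
    intro v hv
    refine ⟨(hspec v hv).1, fun 𝔓 h𝔓 Φ hΦ => ?_⟩
    have h := (FramedGaloisRep.hasFrobCharpolyAt_iff_of_rank_one ψ v _).mp (hspec v hv).2 𝔓 h𝔓 Φ hΦ
    rw [← h, FramedRep.det_apply, Matrix.GeneralLinearGroup.val_det_apply, Matrix.det_fin_one]
  refine ⟨ψ, fun v => ⟨fun hv => (hspec v hv).1, fun hv => ?_⟩, fun v hv => (hspec v ?_).2⟩
  · exact Automorphic.isUnramifiedAt_of_heckeCharacter_isUnramifiedAt ψ η hdet v hv
  · exact Automorphic.isUnramifiedAt_of_heckeCharacter_isUnramifiedAt ψ η hdet v hv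

/-- **Uniqueness of the Artin character of a finite-order Hecke character**: two rank-one Artin
representations whose Frobenius values at their unramified places are `η(ϖ_v)` coincide
(Frobenius' density theorem; tree `FramedArtinRep.eq_of_valueAtUniformizer_eq_det`).
[cite: NeukirchANT1999, Ch. VII §13 (Chebotarev), Ch. VII (10.6)] -/
theorem framedArtinRep_unique (η : HeckeCharacter K) {ψ₁ ψ₂ : FramedArtinRep K 1}
    (h₁ : ∀ v : HeightOneSpectrum (𝓞 K), ψ₁.IsUnramifiedAt v →
      ψ₁.HasFrobCharpolyAt v (X - C (η.valueAtUniformizer v)))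
    (h₂ : ∀ v : HeightOneSpectrum (𝓞 K), ψ₂.IsUnramifiedAt v →
      ψ₂.HasFrobCharpolyAt v (X - C (η.valueAtUniformizer v))) :
    ψ₁ = ψ₂ := by
  refine FramedArtinRep.eq_of_valueAtUniformizer_eq_det η (fun v hv 𝔓 h𝔓 Φ hΦ => ?_)
    (fun v hv 𝔓 h𝔓 Φ hΦ => ?_)
  · have h := (FramedGaloisRep.hasFrobCharpolyAt_iff_of_rank_one ψ₁ v _).mp (h₁ v hv) 𝔓 h𝔓 Φ hΦ
    rw [← h, FramedRep.det_apply, Matrix.GeneralLinearGroup.val_det_apply, Matrix.det_fin_one]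
  · have h := (FramedGaloisRep.hasFrobCharpolyAt_iff_of_rank_one ψ₂ v _).mp (h₂ v hv) 𝔓 h𝔓 Φ hΦ
    rw [← h, FramedRep.det_apply, Matrix.GeneralLinearGroup.val_det_apply, Matrix.det_fin_one]

end HeckeCharacter

/-! ### §3. The `ℓ`-adic avatar of a finite-order Hecke character -/

section LAdic

variable {ℓ : ℕ} [Fact ℓ.Prime]

namespace FramedArtinRep

omit [NumberField K] in
/-- The character `σ ↦ ι⁻¹(det ψ σ)⁻¹ : Γ_K → ℚ̄_ℓˣ` of a rank-one Artin representation `ψ`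
(inverse of the transport of `det ψ` along `ι⁻¹ : ℂ ≃ ℚ̄_ℓ`). [folklore] -/
def lAdicChar (ψ : FramedArtinRep K 1) (ι : PadicAlgCl ℓ ≃+* ℂ) :
    absoluteGaloisGroup K →* (PadicAlgCl ℓ)ˣ :=
  ((Units.map ((ι.symm : ℂ ≃+* PadicAlgCl ℓ) : ℂ →* PadicAlgCl ℓ)).comp
    (FramedRep.det ψ).toMonoidHom)⁻¹

omit [NumberField K] in
/-- Unfolding lemma for `lAdicChar`. [folklore] -/
theorem coe_lAdicChar_apply (ψ : FramedArtinRep K 1) (ι : PadicAlgCl ℓ ≃+* ℂ)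
    (σ : absoluteGaloisGroup K) :
    ((ψ.lAdicChar ι σ : (PadicAlgCl ℓ)ˣ) : PadicAlgCl ℓ) = (ι.symm ((FramedRep.det ψ σ : ℂˣ) : ℂ))⁻¹ := by
  simp only [lAdicChar, MonoidHom.inv_apply, MonoidHom.coe_comp, Function.comp_apply, Units.val_inv_eq_inv_val,
    Units.coe_map, MonoidHom.coe_coe]
  rfl

omit [NumberField K] in
/-- `lAdicChar ψ ι σ = 1 ↔ ψ σ = 1`. [folklore] -/
theorem lAdicChar_apply_eq_one_iff (ψ : FramedArtinRep K 1) (ι : PadicAlgCl ℓ ≃+* ℂ)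
    (σ : absoluteGaloisGroup K) : ψ.lAdicChar ι σ = 1 ↔ ψ σ = 1 := by
  rw [← Automorphic.det_eq_one_iff_rankOne]
  constructor
  · intro h
    have h1 : ((ψ.lAdicChar ι σ : (PadicAlgCl ℓ)ˣ) : PadicAlgCl ℓ) = 1 := by rw [h, Units.val_one]
    rw [coe_lAdicChar_apply, inv_eq_one] at h1
    have h2 := congrArg ι h1
    rw [RingEquiv.apply_symm_apply, map_one] at h2
    exact Units.val_eq_one.mp h2
  · intro h
    ext
    rw [coe_lAdicChar_apply, h, Units.val_one, map_one, inv_one, Units.val_one]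

/-- The kernel of `lAdicChar ψ ι` is the (open) kernel of `ψ`. [folklore] -/
theorem isOpen_ker_lAdicChar (ψ : FramedArtinRep K 1) (ι : PadicAlgCl ℓ ≃+* ℂ) :
    IsOpen ((ψ.lAdicChar ι).ker : Set (absoluteGaloisGroup K)) := by
  have h : ((ψ.lAdicChar ι).ker : Set (absoluteGaloisGroup K)) = ψ.toMonoidHom.ker := by
    ext σ
    simp only [SetLike.mem_coe, MonoidHom.mem_ker]
    exact ψ.lAdicChar_apply_eq_one_iff ι σ
  rw [h]
  exact ψ.isOpen_ker_toMonoidHom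

/-- **The `ℓ`-adic avatar of a rank-one Artin representation**: `σ ↦ ι⁻¹(ψ(σ))⁻¹` as a continuous
`Γ_K → GL_1(ℚ̄_ℓ)`.  Serre 1968, Ch. III §2.3. [cite: SerreAbelianLadic1968, Ch. III §2.3] -/
def lAdicAvatar (ψ : FramedArtinRep K 1) (ι : PadicAlgCl ℓ ≃+* ℂ) : FramedGaloisRep K (PadicAlgCl ℓ) 1 :=
  FramedGaloisRep.ofOpenKer (ψ.lAdicChar ι) (ψ.isOpen_ker_lAdicChar ι)

/-- The avatar is unramified exactly where `ψ` is. [folklore] -/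
theorem isUnramifiedAt_lAdicAvatar_iff (ψ : FramedArtinRep K 1) (ι : PadicAlgCl ℓ ≃+* ℂ)
    (v : HeightOneSpectrum (𝓞 K)) : (ψ.lAdicAvatar ι).IsUnramifiedAt v ↔ ψ.IsUnramifiedAt v := by
  rw [lAdicAvatar, FramedGaloisRep.isUnramifiedAt_ofOpenKer_iff]
  refine forall₂_congr fun 𝔓 _ => forall₂_congr fun σ _ => ?_
  exact ψ.lAdicChar_apply_eq_one_iff ι σ

/-- Frobenius values of the avatar: if `ψ(Φ) = a` for the arithmetic Frobenii above `v`
(`ψ.HasFrobCharpolyAt v (X - C a)`) then the avatar has `HasFrobCharpolyAt v (X - C (ι⁻¹ (a⁻¹)))`.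
[folklore] -/
theorem hasFrobCharpolyAt_lAdicAvatar (ψ : FramedArtinRep K 1) (ι : PadicAlgCl ℓ ≃+* ℂ)
    {v : HeightOneSpectrum (𝓞 K)} {a : ℂ} (h : ψ.HasFrobCharpolyAt v (X - C a)) :
    (ψ.lAdicAvatar ι).HasFrobCharpolyAt v (X - C (ι.symm a⁻¹)) := by
  rw [lAdicAvatar, FramedGaloisRep.hasFrobCharpolyAt_ofOpenKer_iff]
  intro 𝔓 h𝔓 Φ hΦ
  have h' := (FramedGaloisRep.hasFrobCharpolyAt_iff_of_rank_one ψ v a).mp h 𝔓 h𝔓 Φ hΦ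
  rw [coe_lAdicChar_apply, map_inv₀, FramedRep.det_apply, Matrix.GeneralLinearGroup.val_det_apply,
    Matrix.det_fin_one, h']

end FramedArtinRep

/-- **The `ℓ`-adic character of a finite-order Hecke character** (the case `n = 1`, finite order, of
the automorphic-to-Galois direction; Serre 1968 Ch. III §2.3 with class field theory, Tate,
Cassels–Fröhlich VII §5.1).  For a Hecke character `η` of finite order of the number field `K`, a
prime `ℓ` and a field isomorphism `ι : ℚ̄_ℓ ≃+* ℂ`, there is a continuous
`r : Γ_K → GL_1(ℚ̄_ℓ)` which is unramified at a finite place `v` iff `η` is, and whose arithmetic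
Frobenii at every such `v` have characteristic polynomial `X - ι⁻¹(η(ϖ_v))⁻¹`
(`= arithFrobPolyOfSatake ι q_v 1 {η(ϖ_v)}` of `Automorphic/ReciprocityGLn`: the geometric Frobenius
corresponds to the uniformizer).
[cite: SerreAbelianLadic1968, Ch. III §2.3] [cite: CasselsFrohlichANT1967, Ch. VII §5.1 Main Theorem]
[cite: HarrisLanTaylorThorneRMS2016, Thm. 7.13, p. 232 ("in the case n = 1 the result is well known")] -/
theorem HeckeCharacter.exists_lAdic_of_isFiniteOrder (η : HeckeCharacter K) (hη : η.IsFiniteOrder)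
    (ι : PadicAlgCl ℓ ≃+* ℂ) :
    ∃ r : FramedGaloisRep K (PadicAlgCl ℓ) 1,
      (∀ v : HeightOneSpectrum (𝓞 K), r.IsUnramifiedAt v ↔ η.IsUnramifiedAt v) ∧
      ∀ v : HeightOneSpectrum (𝓞 K), η.IsUnramifiedAt v →
        r.HasFrobCharpolyAt v (X - C (ι.symm (η.valueAtUniformizer v)⁻¹)) := by
  obtain ⟨ψ, hram, hfrob⟩ := η.exists_framedArtinRep_of_isFiniteOrder hη
  refine ⟨ψ.lAdicAvatar ι, fun v => (ψ.isUnramifiedAt_lAdicAvatar_iff ι v).trans (hram v),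
    fun v hv => ?_⟩
  exact ψ.hasFrobCharpolyAt_lAdicAvatar ι (hfrob v hv)

end LAdic

end Literature.NumberTheory.GaloisRepresentations

end
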